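import Summits.AtomisticToContinuum.Crystallization.Theorems.MinimisingLawsHaveAtoms.Negative.DilatedLawMecke
import Summits.AtomisticToContinuum.Crystallization.Theorems.PalmUnimodularRigidityBenjaminiSchrammLimitEnergy
import Summits.AtomisticToContinuum.Crystallization.Theorems.PalmUnimodularRigidityUnimodularEnergyLowerBoundHardCore
import Mathlib.Analysis.Normed.Group.Bounded

/-!
# Negative knowledge for crux `MinimisingLawsHaveAtoms` (stmt-AtomisticToContinuum-15776), X:
# the energy of the randomly dilated law moves by `O(E[c − 1])`

Standing crux disprover `cdisprove-stmt-AtomisticToContinuum-15776`,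
`--supports stmt-AtomisticToContinuum-15776`; fifth piece of the threshold-sharpness programme.

* `lennardJones_mul_sub_le` — `V_LJ(c r) − V_LJ(r) ≤ (c − 1) r⁻⁶` for `c ≥ 1`, `r > 0` (the
  repulsion only decreases under dilation; `1 − c⁻⁶ ≤ 6(c − 1)`);
* `lintegral_ofReal_inv_pow_six_le` — `∑_{z ∈ S} ‖z‖⁻⁶ ≤ 250 δ⁻⁶` over a rooted `δ`-separated `S`
  (the landed shell bound `UnimodularEnergy.sum_erase_inv_pow_six_le`, `lintegral` form);
* `integral_lennardJones_map_smul_sub_le` — **dilating a rooted `δ`-hard-core configuration by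
  `c ≥ 1` raises the (genuine, Bochner) root energy sum by at most `(c − 1) · 250 δ⁻⁶`**;
* `integral_rootEnergy_dilatedLaw_le` — hence the mean root energy of the randomly dilated law
  (Part IX) with dilation factor `c ∈ [1, 2]` a.s. is at most
  `E_Q[h] + 125 δ⁻⁶ · E_ν[c − 1]`: dilating the abstract minimising law by `c` uniform on
  `[1, 1 + η]` costs at most `125 δ⁻⁶ η / 2` above `e*`.
All `[folklore]`.
-/

noncomputable section

namespace Summit.AtomisticToContinuum.Crystallization.Theorems.MinimisingLawsHaveAtoms.Negative.DilatedLawEnergy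

open MeasureTheory Set Filter Function
open scoped ENNReal Topology
open Literature.MathematicalPhysics.StatisticalMechanics Literature.Probability.Process
open Literature.Probability.Process.LocalConfig
open Summit.AtomisticToContinuum.Crystallization.Theorems.BenjaminiSchrammLimit
  (measurableEmbedding_toMeasure integrable_lennardJones_toMeasure
    continuous_integral_lennardJones_toMeasure measurable_lennardJones_norm)
open Summit.AtomisticToContinuum.Crystallization.Theorems.UnimodularEnergy
  (sum_erase_inv_pow_six_le countable_of_separated lintegral_count_restrict)
open Summit.AtomisticToContinuum.Crystallization.Theorems.MinimisingLawsHaveAtoms.Negative.DilationFamily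

/-! ## §1 The pair potential under dilation -/

/-- `1 − c⁻⁶ ≤ 6 (c − 1)` for `c ≥ 1`. [folklore] -/
theorem one_sub_inv_pow_six_le {c : ℝ} (hc : 1 ≤ c) : 1 - (c⁻¹) ^ 6 ≤ 6 * (c - 1) := by
  have hc0 : 0 < c := by positivity
  set u : ℝ := c⁻¹ with hu
  have hu0 : 0 ≤ u := by positivity
  have hu1 : u ≤ 1 := inv_le_one_of_one_le₀ hc
  have hfac : 1 - u ^ 6 = (1 - u) * (1 + u + u ^ 2 + u ^ 3 + u ^ 4 + u ^ 5) := by ring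
  have hsum : 1 + u + u ^ 2 + u ^ 3 + u ^ 4 + u ^ 5 ≤ 6 := by
    have h2 : u ^ 2 ≤ 1 := pow_le_one₀ hu0 hu1
    have h3 : u ^ 3 ≤ 1 := pow_le_one₀ hu0 hu1
    have h4 : u ^ 4 ≤ 1 := pow_le_one₀ hu0 hu1
    have h5 : u ^ 5 ≤ 1 := pow_le_one₀ hu0 hu1
    linarith
  have h1u : 1 - u ≤ c - 1 := by
    have : 1 - u = (c - 1) / c := by rw [hu]; field_simp
    rw [this, div_le_iff₀ hc0]
    nlinarith
  rw [hfac]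
  calc (1 - u) * (1 + u + u ^ 2 + u ^ 3 + u ^ 4 + u ^ 5) ≤ (1 - u) * 6 :=
        mul_le_mul_of_nonneg_left hsum (by linarith)
    _ ≤ (c - 1) * 6 := mul_le_mul_of_nonneg_right h1u (by norm_num)
    _ = 6 * (c - 1) := by ring

/-- **`V_LJ(c r) − V_LJ(r) ≤ (c − 1) r⁻⁶`** for `c ≥ 1`, `r > 0`: the repulsive term only decreases,
the attractive one increases by `(1/6)(1 − c⁻⁶) r⁻⁶`. [folklore] -/
theorem lennardJones_mul_sub_le {c r : ℝ} (hc : 1 ≤ c) (hr : 0 < r) :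
    lennardJones (c * r) - lennardJones r ≤ (c - 1) * (r⁻¹) ^ 6 := by
  have hc0 : 0 < c := by positivity
  have hu1 : c⁻¹ ≤ 1 := inv_le_one_of_one_le₀ hc
  have hu0 : 0 ≤ c⁻¹ := by positivity
  have h12 : (c⁻¹) ^ 12 ≤ 1 := pow_le_one₀ hu0 hu1
  have hr6 : 0 ≤ (r⁻¹) ^ 6 := by positivity
  have hr12 : 0 ≤ (r⁻¹) ^ 12 := by positivity
  have h6 := one_sub_inv_pow_six_le hc
  have hexp : lennardJones (c * r) - lennardJones r =
      (1 / 12) * ((c⁻¹) ^ 12 - 1) * (r⁻¹) ^ 12 + (1 / 6) * (1 - (c⁻¹) ^ 6) * (r⁻¹) ^ 6 := by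
    unfold lennardJones
    rw [mul_inv, mul_pow, mul_pow]
    ring
  rw [hexp]
  nlinarith [mul_le_mul_of_nonneg_right h6 hr6, mul_nonneg (sub_nonneg.2 h12) hr12]

/-! ## §2 The shell bound `∑ ‖z‖⁻⁶ ≤ 250 δ⁻⁶` in integral form -/

/-- `∑_{z ∈ S} ‖z‖⁻⁶ ≤ 250 δ⁻⁶` for a rooted `δ`-separated `S` (the root's own term is `0⁻¹ = 0`).
[folklore] -/
theorem lintegral_ofReal_inv_pow_six_le {δ : ℝ} (hδ : 0 < δ) {S : Set (EuclideanSpace ℝ (Fin 3))}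
    (hsep : ∀ x ∈ S, ∀ y ∈ S, x ≠ y → δ ≤ dist x y) (h0 : (0 : EuclideanSpace ℝ (Fin 3)) ∈ S) :
    ∫⁻ z, ENNReal.ofReal ((‖z‖⁻¹) ^ 6) ∂((Measure.count : Measure (EuclideanSpace ℝ (Fin 3))).restrict S)
      ≤ ENNReal.ofReal (250 * δ⁻¹ ^ 6) := by
  classical
  rw [lintegral_count_restrict (countable_of_separated hδ hsep), ENNReal.tsum_eq_iSup_sum]
  refine iSup_le fun T' => ?_
  set T : Finset (EuclideanSpace ℝ (Fin 3)) :=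
    insert 0 (T'.map (Function.Embedding.subtype (· ∈ S))) with hT
  have hTS : ∀ z ∈ T, z ∈ S := by
    intro z hz
    rcases Finset.mem_insert.1 hz with rfl | hz
    · exact h0
    · obtain ⟨w, -, rfl⟩ := Finset.mem_map.1 hz
      exact w.2
  have hsepT : ∀ x ∈ T, ∀ z ∈ T, x ≠ z → δ ≤ dist x z := fun x hx z hz hxz =>
    hsep x (hTS x hx) z (hTS z hz) hxz
  have hyT : (0 : EuclideanSpace ℝ (Fin 3)) ∈ T := Finset.mem_insert_self _ _
  calc ∑ z ∈ T', ENNReal.ofReal ((‖(z : EuclideanSpace ℝ (Fin 3))‖⁻¹) ^ 6)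
      = ∑ z ∈ T'.map (Function.Embedding.subtype (· ∈ S)), ENNReal.ofReal ((‖z‖⁻¹) ^ 6) := by
        rw [Finset.sum_map]; rfl
    _ ≤ ∑ z ∈ T, ENNReal.ofReal ((‖z‖⁻¹) ^ 6) :=
        Finset.sum_le_sum_of_subset (Finset.subset_insert _ _)
    _ = ∑ z ∈ T.erase 0, ENNReal.ofReal ((‖z‖⁻¹) ^ 6) := by
        rw [← Finset.add_sum_erase T _ hyT]
        simp
    _ = ∑ z ∈ T.erase 0, ENNReal.ofReal ((dist (0 : EuclideanSpace ℝ (Fin 3)) z)⁻¹ ^ 6) := by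
        refine Finset.sum_congr rfl fun z _ => ?_
        rw [dist_zero_left]
    _ = ENNReal.ofReal (∑ z ∈ T.erase 0, (dist (0 : EuclideanSpace ℝ (Fin 3)) z)⁻¹ ^ 6) :=
        (ENNReal.ofReal_sum_of_nonneg fun z _ => by positivity).symm
    _ ≤ ENNReal.ofReal (250 * δ⁻¹ ^ 6) :=
        ENNReal.ofReal_le_ofReal (sum_erase_inv_pow_six_le hδ T hsepT hyT)

/-! ## §3 Dilation raises the root energy by at most `(c − 1) · 250 δ⁻⁶` -/

variable {δ : ℝ} [Fact (0 < δ)]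

/-- `x ↦ ‖x‖⁻⁶` is integrable against `count|S` for a rooted `δ`-hard-core `S`, with integral
`≤ 250 δ⁻⁶`. [folklore] -/
theorem integral_inv_pow_six_le (S : RootedHardCoreConfig (EuclideanSpace ℝ (Fin 3)) δ) :
    Integrable (fun x : EuclideanSpace ℝ (Fin 3) => (‖x‖⁻¹) ^ 6)
        ((S.1 : LocalConfig (EuclideanSpace ℝ (Fin 3))).toMeasure) ∧
      ∫ x, (‖x‖⁻¹) ^ 6 ∂((S.1 : LocalConfig (EuclideanSpace ℝ (Fin 3))).toMeasure) ≤ 250 * δ⁻¹ ^ 6 := by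
  have hδ : 0 < δ := Fact.out
  have hmeas : Measurable fun x : EuclideanSpace ℝ (Fin 3) => (‖x‖⁻¹) ^ 6 :=
    (measurable_norm.inv).pow_const 6
  have hlin := lintegral_ofReal_inv_pow_six_le hδ S.2.2 S.2.1
  rw [← toMeasure_def] at hlin
  have hnn : 0 ≤ᵐ[((S.1 : LocalConfig (EuclideanSpace ℝ (Fin 3))).toMeasure)]
      fun x : EuclideanSpace ℝ (Fin 3) => (‖x‖⁻¹) ^ 6 :=
    Eventually.of_forall fun x => by positivity
  have hint : Integrable (fun x : EuclideanSpace ℝ (Fin 3) => (‖x‖⁻¹) ^ 6)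
      ((S.1 : LocalConfig (EuclideanSpace ℝ (Fin 3))).toMeasure) := by
    refine ⟨hmeas.aestronglyMeasurable, ?_⟩
    rw [hasFiniteIntegral_iff_ofReal hnn]
    exact hlin.trans_lt ENNReal.ofReal_lt_top
  refine ⟨hint, ?_⟩
  rw [integral_eq_lintegral_of_nonneg_ae hnn hmeas.aestronglyMeasurable]
  exact ENNReal.toReal_le_of_le_ofReal (by positivity) hlin

/-- **Dilation raises the root energy sum by at most `(c − 1) · 250 δ⁻⁶`**: for a rooted
`δ`-hard-core configuration `S` and `c ≥ 1`,
`∫ V_LJ d((c•·)_* count|S) − ∫ V_LJ d(count|S) ≤ (c − 1) · 250 δ⁻⁶` (both genuine Bochner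
integrals). [folklore] -/
theorem integral_lennardJones_map_smul_sub_le
    (S : RootedHardCoreConfig (EuclideanSpace ℝ (Fin 3)) δ) {c : ℝ} (hc : 1 ≤ c) :
    (∫ y, lennardJones ‖y‖ ∂(((S.1 : LocalConfig (EuclideanSpace ℝ (Fin 3))).toMeasure).map
        fun x : EuclideanSpace ℝ (Fin 3) => c • x)) -
      ∫ y, lennardJones ‖y‖ ∂((S.1 : LocalConfig (EuclideanSpace ℝ (Fin 3))).toMeasure) ≤
      (c - 1) * (250 * δ⁻¹ ^ 6) := by
  have hδ : 0 < δ := Fact.out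
  have hc0 : c ≠ 0 := by positivity
  have hint := integrable_lennardJones_toMeasure hδ S
  -- the dilate as a rooted hard-core configuration
  set Sc : RootedHardCoreConfig (EuclideanSpace ℝ (Fin 3)) δ :=
    ⟨LocalConfig.mk ((fun x : EuclideanSpace ℝ (Fin 3) => c • x) ''
      ((S.1 : LocalConfig (EuclideanSpace ℝ (Fin 3))) : Set (EuclideanSpace ℝ (Fin 3)))),
      smul_image_rooted_separated hc S.2.1 S.2.2⟩ with hSc
  have hmapeq : ((S.1 : LocalConfig (EuclideanSpace ℝ (Fin 3))).toMeasure).map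
      (fun x : EuclideanSpace ℝ (Fin 3) => c • x) =
        (Sc.1 : LocalConfig (EuclideanSpace ℝ (Fin 3))).toMeasure := by
    rw [toMeasure_def, toMeasure_def, map_smul_count_restrict hc0]
    rfl
  have hint_c : Integrable (fun y : EuclideanSpace ℝ (Fin 3) => lennardJones ‖y‖)
      (((S.1 : LocalConfig (EuclideanSpace ℝ (Fin 3))).toMeasure).map
        fun x : EuclideanSpace ℝ (Fin 3) => c • x) := by
    rw [hmapeq]; exact integrable_lennardJones_toMeasure hδ Sc
  have hint' : Integrable (fun x : EuclideanSpace ℝ (Fin 3) => lennardJones ‖c • x‖)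
      ((S.1 : LocalConfig (EuclideanSpace ℝ (Fin 3))).toMeasure) :=
    (integrable_map_measure hint_c.aestronglyMeasurable (measurable_const_smul c).aemeasurable).1
      hint_c
  rw [integral_map (measurable_const_smul c).aemeasurable hint_c.aestronglyMeasurable,
    ← integral_sub hint' hint]
  -- pointwise bound
  have hle : ∀ x : EuclideanSpace ℝ (Fin 3),
      lennardJones ‖c • x‖ - lennardJones ‖x‖ ≤ (c - 1) * (‖x‖⁻¹) ^ 6 := fun x => by
    by_cases hx : x = 0
    · subst hx
      simp [lennardJones_zero]
    · rw [norm_smul, Real.norm_of_nonneg (by positivity)]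
      exact lennardJones_mul_sub_le hc (norm_pos_iff.2 hx)
  obtain ⟨hint6, hbd6⟩ := integral_inv_pow_six_le S
  calc ∫ x, lennardJones ‖c • x‖ - lennardJones ‖x‖
        ∂((S.1 : LocalConfig (EuclideanSpace ℝ (Fin 3))).toMeasure)
      ≤ ∫ x, (c - 1) * (‖x‖⁻¹) ^ 6 ∂((S.1 : LocalConfig (EuclideanSpace ℝ (Fin 3))).toMeasure) :=
        integral_mono (hint'.sub hint) (hint6.const_mul _) hle
    _ = (c - 1) * ∫ x, (‖x‖⁻¹) ^ 6 ∂((S.1 : LocalConfig (EuclideanSpace ℝ (Fin 3))).toMeasure) :=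
        integral_const_mul _ _
    _ ≤ (c - 1) * (250 * δ⁻¹ ^ 6) := mul_le_mul_of_nonneg_left hbd6 (by linarith)

/-- The same in `rootEnergy` form: `h((c•·)_* count|S) ≤ h(count|S) + (c − 1) · 125 δ⁻⁶`.
[folklore] -/
theorem rootEnergy_map_smul_le (S : RootedHardCoreConfig (EuclideanSpace ℝ (Fin 3)) δ) {c : ℝ}
    (hc : 1 ≤ c) :
    rootEnergy lennardJones (((S.1 : LocalConfig (EuclideanSpace ℝ (Fin 3))).toMeasure).map
        fun x : EuclideanSpace ℝ (Fin 3) => c • x) ≤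
      rootEnergy lennardJones ((S.1 : LocalConfig (EuclideanSpace ℝ (Fin 3))).toMeasure) +
        (c - 1) * (125 * δ⁻¹ ^ 6) := by
  have h := integral_lennardJones_map_smul_sub_le S hc
  rw [rootEnergy_def, rootEnergy_def]
  linarith

/-! ## §4 The mean root energy of the randomly dilated law -/

/-- The root energy is continuous, hence bounded, on the compact configuration space. [folklore] -/
theorem exists_bound_rootEnergy_toMeasure :
    ∃ C : ℝ, ∀ S : RootedHardCoreConfig (EuclideanSpace ℝ (Fin 3)) δ,
      |rootEnergy lennardJones ((S.1 : LocalConfig (EuclideanSpace ℝ (Fin 3))).toMeasure)| ≤ C := by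
  have hδ : 0 < δ := Fact.out
  have hcont : Continuous fun S : RootedHardCoreConfig (EuclideanSpace ℝ (Fin 3)) δ =>
      rootEnergy lennardJones ((S.1 : LocalConfig (EuclideanSpace ℝ (Fin 3))).toMeasure) := by
    simp only [rootEnergy_def]
    exact (continuous_integral_lennardJones_toMeasure hδ).div_const 2
  obtain ⟨C, hC⟩ := isCompact_univ.exists_bound_of_continuousOn hcont.continuousOn
  exact ⟨C, fun S => by simpa [Real.norm_eq_abs] using hC S (mem_univ S)⟩

/-- **Mean root energy of the randomly dilated law.** For probability laws `Q` (configurations)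
and `ν` (dilation factor, a.s. in `[1, 2]`),
`E_{dilated}[h] ≤ E_Q[h] + 125 δ⁻⁶ · E_ν[c − 1]`. [folklore] -/
theorem integral_rootEnergy_dilatedLaw_le
    (Q : Measure (RootedHardCoreConfig (EuclideanSpace ℝ (Fin 3)) δ)) [IsProbabilityMeasure Q]
    (ν : Measure ℝ) [IsProbabilityMeasure ν] (hν : ∀ᵐ c ∂ν, 1 ≤ c ∧ c ≤ 2) :
    (∫ μ, rootEnergy lennardJones μ ∂(((ν.prod Q).map
      fun p : ℝ × RootedHardCoreConfig (EuclideanSpace ℝ (Fin 3)) δ =>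
        (⟨LocalConfig.mk ((fun x : EuclideanSpace ℝ (Fin 3) => max p.1 1 • x) ''
            ((p.2.1 : LocalConfig (EuclideanSpace ℝ (Fin 3))) : Set (EuclideanSpace ℝ (Fin 3)))),
          smul_image_rooted_separated (le_max_right _ _) p.2.2.1 p.2.2.2⟩ :
            RootedHardCoreConfig (EuclideanSpace ℝ (Fin 3)) δ)).map
      fun S : RootedHardCoreConfig (EuclideanSpace ℝ (Fin 3)) δ =>
        (S.1 : LocalConfig (EuclideanSpace ℝ (Fin 3))).toMeasure)) ≤
      (∫ S, rootEnergy lennardJones ((S.1 : LocalConfig (EuclideanSpace ℝ (Fin 3))).toMeasure) ∂Q) +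
        125 * δ⁻¹ ^ 6 * ∫ c, (c - 1) ∂ν := by
  have hδ : 0 < δ := Fact.out
  have hE := measurableEmbedding_toMeasure (EuclideanSpace ℝ (Fin 3)) (δ := δ)
  have hΨc := continuous_dilate (δ := δ)
  have hΨ := measurable_dilate (δ := δ)
  obtain ⟨C, hC⟩ := exists_bound_rootEnergy_toMeasure (δ := δ)
  have hcontH : Continuous fun S : RootedHardCoreConfig (EuclideanSpace ℝ (Fin 3)) δ =>
      rootEnergy lennardJones ((S.1 : LocalConfig (EuclideanSpace ℝ (Fin 3))).toMeasure) := by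
    simp only [rootEnergy_def]
    exact (continuous_integral_lennardJones_toMeasure hδ).div_const 2
  -- the integrand on the product space
  set F : ℝ × RootedHardCoreConfig (EuclideanSpace ℝ (Fin 3)) δ → ℝ := fun p =>
    rootEnergy lennardJones (((⟨LocalConfig.mk ((fun x : EuclideanSpace ℝ (Fin 3) =>
      max p.1 1 • x) '' ((p.2.1 : LocalConfig (EuclideanSpace ℝ (Fin 3))) :
        Set (EuclideanSpace ℝ (Fin 3)))), smul_image_rooted_separated (le_max_right _ _)
          p.2.2.1 p.2.2.2⟩ : RootedHardCoreConfig (EuclideanSpace ℝ (Fin 3)) δ).1 :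
            LocalConfig (EuclideanSpace ℝ (Fin 3))).toMeasure) with hFdef
  have hFcont : Continuous F := hcontH.comp hΨc
  have hFbd : ∀ p, ‖F p‖ ≤ C := fun p => by
    rw [Real.norm_eq_abs]; exact hC _
  have hFint : Integrable F (ν.prod Q) :=
    (integrable_const C).mono' hFcont.aestronglyMeasurable (Eventually.of_forall hFbd)
  -- `E_L[h] = ∫ F d(ν ⊗ Q)`
  have h1 : (∫ μ, rootEnergy lennardJones μ ∂(((ν.prod Q).map
      fun p : ℝ × RootedHardCoreConfig (EuclideanSpace ℝ (Fin 3)) δ =>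
        (⟨LocalConfig.mk ((fun x : EuclideanSpace ℝ (Fin 3) => max p.1 1 • x) ''
            ((p.2.1 : LocalConfig (EuclideanSpace ℝ (Fin 3))) : Set (EuclideanSpace ℝ (Fin 3)))),
          smul_image_rooted_separated (le_max_right _ _) p.2.2.1 p.2.2.2⟩ :
            RootedHardCoreConfig (EuclideanSpace ℝ (Fin 3)) δ)).map
      fun S : RootedHardCoreConfig (EuclideanSpace ℝ (Fin 3)) δ =>
        (S.1 : LocalConfig (EuclideanSpace ℝ (Fin 3))).toMeasure)) = ∫ p, F p ∂(ν.prod Q) := by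
    rw [hE.integral_map, integral_map hΨ.aemeasurable hcontH.aestronglyMeasurable]
  rw [h1, integral_prod _ hFint]
  -- inner bound, for a.e. dilation factor
  have h2 : ∀ᵐ c ∂ν, (∫ S, F (c, S) ∂Q) ≤
      (∫ S, rootEnergy lennardJones ((S.1 : LocalConfig (EuclideanSpace ℝ (Fin 3))).toMeasure) ∂Q) +
        125 * δ⁻¹ ^ 6 * (c - 1) := hν.mono fun c hc => by
    have hmax : max c 1 = c := max_eq_left hc.1
    have hintc : Integrable (fun S => F (c, S)) Q :=
      (integrable_const C).mono' (hFcont.comp (Continuous.prodMk_right c)).aestronglyMeasurable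
        (Eventually.of_forall fun S => hFbd (c, S))
    have hintH : Integrable (fun S : RootedHardCoreConfig (EuclideanSpace ℝ (Fin 3)) δ =>
        rootEnergy lennardJones ((S.1 : LocalConfig (EuclideanSpace ℝ (Fin 3))).toMeasure)) Q :=
      (integrable_const C).mono' hcontH.aestronglyMeasurable
        (Eventually.of_forall fun S => by rw [Real.norm_eq_abs]; exact hC S)
    have hpt : ∀ S : RootedHardCoreConfig (EuclideanSpace ℝ (Fin 3)) δ, F (c, S) ≤
        rootEnergy lennardJones ((S.1 : LocalConfig (EuclideanSpace ℝ (Fin 3))).toMeasure) +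
          (c - 1) * (125 * δ⁻¹ ^ 6) := fun S => by
      have := rootEnergy_map_smul_le S hc.1
      simp only [hFdef]
      rw [toMeasure_dilate, hmax]
      exact this
    calc (∫ S, F (c, S) ∂Q)
        ≤ ∫ S, (rootEnergy lennardJones ((S.1 : LocalConfig (EuclideanSpace ℝ (Fin 3))).toMeasure) +
            (c - 1) * (125 * δ⁻¹ ^ 6)) ∂Q :=
          integral_mono hintc (hintH.add (integrable_const _)) hpt
      _ = (∫ S, rootEnergy lennardJones ((S.1 : LocalConfig (EuclideanSpace ℝ (Fin 3))).toMeasure) ∂Q) +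
            125 * δ⁻¹ ^ 6 * (c - 1) := by
          rw [integral_add hintH (integrable_const _), integral_const, probReal_univ, one_smul]
          ring
  -- outer integration
  have hintc1 : Integrable (fun c : ℝ => c - 1) ν :=
    (integrable_const (1 : ℝ)).mono' (measurable_id.sub_const 1).aestronglyMeasurable
      (hν.mono fun c hc => by rw [Real.norm_eq_abs, abs_le]; constructor <;> linarith [hc.1, hc.2])
  calc (∫ c, ∫ S, F (c, S) ∂Q ∂ν)
      ≤ ∫ c, ((∫ S, rootEnergy lennardJones
          ((S.1 : LocalConfig (EuclideanSpace ℝ (Fin 3))).toMeasure) ∂Q) + 125 * δ⁻¹ ^ 6 * (c - 1)) ∂ν :=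
        integral_mono_ae hFint.integral_prod_left
          ((integrable_const _).add (hintc1.const_mul _)) h2
    _ = (∫ S, rootEnergy lennardJones ((S.1 : LocalConfig (EuclideanSpace ℝ (Fin 3))).toMeasure) ∂Q) +
          125 * δ⁻¹ ^ 6 * ∫ c, (c - 1) ∂ν := by
        rw [integral_add (integrable_const _) (hintc1.const_mul _), integral_const, probReal_univ,
          one_smul, integral_const_mul]

end Summit.AtomisticToContinuum.Crystallization.Theorems.MinimisingLawsHaveAtoms.Negative.DilatedLawEnergy

end
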